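import Summits.CriticalPhenomena.PercolationContinuityZ3.Theorems.PercNearOneGluingNoHeavyQuantPowerLawInputs
import Literature.Probability.Percolation.HutchcroftGammaLeDeltaSubOneHolds
import HarnessLib

/-!
# PAPER-2 track, ARM-3 gen 4: route (C)'s input from a critical VOLUME exponent, UNCONDITIONAL in the kernel

builds on p205010 (kernel theorem, internal audit signed; external expert review pending).
Status sentence for p205010: "θ(p_c) = 0 on ℤ^d, all d ≥ 2 — kernel-verified (Lean 4/Mathlib, standard
axioms); internal adversarial audit SIGNED 2026-08-20 04:29Z; external expert review pending."

With Hutchcroft's `γ ≤ δ − 1` proved (`Literature.Probability.Percolation.Hutchcroft2020_gamma_le_delta_sub_one_holds`, gen 4,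
p251444), a critical volume tail `P_{p_c}(|C(0)| ≥ k) ≤ A k^{−a}` with ANY exponent `a ∈ (0, 1)` gives a subcritical susceptibility
power bound with `g = 1/a − 1` on the whole subcritical interval (`chiSubcritPowerBound_of_volumeTail`), hence the input
`SubcriticalGammaLtTwo d` of route (C) as soon as `a > 1/3` (`subcriticalGammaLtTwo_of_volumeTail`).  In the mean-field picture
`a = 1/2` (δ = 2) and the output `g = 1` is sharp; in `d = 3` the predicted `a = 1/δ ≈ 0.19 < 1/3`, so this implication — like
the one-arm version `c > d/4` of `…QuantGammaOfOneArmHolds.lean` — is a dictionary row, not a route: it says which strength of a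
critical volume bound would settle Question q:chi.  Helper of item stmt-CriticalPhenomena-4575; nothing here is an input of p205010.
-/

noncomputable section

open MeasureTheory Literature.Probability.Percolation Literature.Probability.LatticeModels

namespace Summit.CriticalPhenomena.PercolationContinuityZ3.Theorems.Quant

variable {d : ℕ}

/-- **Critical volume tail with exponent `a ∈ (0,1)` ⇒ `ChiSubcritPowerBound d M (1/a − 1) 1`** (`d ≥ 1`), by Hutchcroft 2020
Thm 1.1 (`γ ≤ δ − 1`, kernel) with `δ = 1/a`.  [cite: Hutchcroft2020, Thm. 1.1] -/
theorem chiSubcritPowerBound_of_volumeTail (hd : 1 ≤ d) {a A : ℝ} (ha0 : 0 < a) (ha1 : a < 1)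
    (h : ∀ k : ℕ, 1 ≤ k → (bondPercolation (zdGraph d) (criticalProbI d)).real (clusterSizeGe (0 : Site d) k)
      ≤ A * (k : ℝ) ^ (-a)) :
    ∃ M : ℝ, ChiSubcritPowerBound d M (1 / a - 1) 1 := by
  have hδ : 1 < 1 / a := by rw [lt_div_iff₀ ha0]; linarith
  have h' : ∀ k : ℕ, 1 ≤ k → (bondPercolation (zdGraph d) (criticalProbI d)).real (clusterSizeGe (0 : Site d) k)
      ≤ A * (k : ℝ) ^ (-(1 / (1 / a))) := by
    intro k hk; rw [one_div_one_div]; exact h k hk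
  obtain ⟨C'', hC''0, hχ⟩ := Hutchcroft2020_gamma_le_delta_sub_one_holds d hd A (1 / a) hδ h'
  refine ⟨C'' ^ (1 / a - 1), fun q _ hq => ?_⟩
  have hpos : 0 < (criticalProbI d : ℝ) - q := by linarith
  have h1 := hχ q hq
  rw [Real.div_rpow hC''0.le hpos.le] at h1
  rw [Real.rpow_neg hpos.le, ← div_eq_mul_inv]
  exact h1

/-- **Critical volume tail with exponent `a > 1/3` ⇒ `SubcriticalGammaLtTwo d`** (route (C)'s input; `γ' = 1/a − 1 < 2`), `d ≥ 1`,
unconditionally in the kernel. [cite: Hutchcroft2020, Thm. 1.1] -/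
theorem subcriticalGammaLtTwo_of_volumeTail (hd : 1 ≤ d) {a A : ℝ} (ha : 1 / 3 < a) (ha1 : a < 1)
    (h : ∀ k : ℕ, 1 ≤ k → (bondPercolation (zdGraph d) (criticalProbI d)).real (clusterSizeGe (0 : Site d) k)
      ≤ A * (k : ℝ) ^ (-a)) :
    SubcriticalGammaLtTwo d := by
  have ha0 : 0 < a := by linarith
  obtain ⟨M, hM⟩ := chiSubcritPowerBound_of_volumeTail hd ha0 ha1 h
  refine ⟨M, 1 / a - 1, 1, ?_, one_pos, hM⟩
  have : 1 / a < 3 := by rw [div_lt_iff₀ ha0]; linarith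
  linarith

end Summit.CriticalPhenomena.PercolationContinuityZ3.Theorems.Quant

end
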